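import Literature.AlgebraicGeometry.AbelianSchemes.AbelianSchemeRelDimOfConnected
import Literature.AlgebraicGeometry.AbelianSchemes.AbelianSchemeOverFibreDim
import Literature.AlgebraicGeometry.AbelianSchemes.DualPairHatRelDimTransport
import HarnessLib

/-!
# Relative dimension of an abelian scheme from ONE fibre over a connected base, and along a base-change square `IsBaseChangeVia`
# (the two phrasings of `RGDInputsAt.relDim` for the SP1 spread `𝒜ₜ` of the generic `A_K`, `dim A_K = g` — no letter)

Topic `AlgebraicGeometry/AbelianSchemes`; namespace `Literature.AlgebraicGeometry.AbelianSchemes.AbelianSchemeOver`.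
THEOREMS ONLY (no definition, no structure, no instance, no named fact, no `sorry`); books 0.

Cell hodgecm-mathlib (D-0151), P6 «MOD programme», row **(s2-g) «REL-DIM OF THE SPREAD, NO LETTER»** (LEAD F0P6-plan (g3) deal
2026-09-01T23:25:17Z; B-p04 (g40) census 23:31Z: the SP1 road already RETURNS `𝒜ₜ.IsOfRelDim g` — ★ `exists_stage_of_generic_of_isOfRelDim`
— from `𝒜.IsOfRelDim g` on the generic base; this file adds the two glue lemmas that were NOT in the tree):
* §1 **`isOfRelDim_of_dim_fibre_eq`** — over a CONNECTED base, an abelian scheme whose fibre at ONE field-valued point has dimension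
  `g` is of relative dimension `g` (★ `exists_isOfRelDim`: a connected base carries one relative dimension, [MumfordFogartyKirwan1994]
  Def. 7.2 ∕ [GortzWedhorn2020] Remark 16.54; read off at the point by ★ `dim_fibre_of_isOfRelDim`) — the head «`dim A_K = g` ⇒
  `𝒜ₜ.IsOfRelDim g` over the connected `Spec A[1∕t]`»; `isOfRelDim_iff_dim_fibre_eq`; `dim_fibre_eq_dim_fibre` (any two fibres of one
  abelian scheme over a connected base have the same dimension);
* §2 **`IsOfRelDim.of_isBaseChangeVia`** — relative dimension `g` rides a base-change square of group schemes `A′.IsBaseChangeVia A f G`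
  ([MumfordFogartyKirwan1994] Def. 7.2 «`X ×_S T`»): Mathlib `MorphismProperty.of_isPullback` for `SmoothOfRelativeDimension g`
  (stable under base change) on the cartesian square of the datum — for consumers whose stage object is `IsBaseChangeVia`-typed
  rather than a literal ★ `baseChange` (for which ★ `IsOfRelDim.baseChange` is the token); `IsOfRelDim.of_isPullback` (bare square);
* §3 the dual side rides too: `DualPair.isOfRelDim_hat_of_isBaseChangeVia_hat` (pattern of use with ★ `DualPairHatRelDimTransport`).
HC_CM is proved only modulo the printed citations (2 remaining named inputs hLiu418 24832, h413 24833) until rung 0 closes; this file is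
count-neutral and discharges none of them.

## References
* [MumfordFogartyKirwan1994] D. Mumford, J. Fogarty, F. Kirwan, *Geometric Invariant Theory*, 3rd ed. (1994), Ch. 7 §2 Definition 7.2
  (p. 129) (abelian scheme of relative dimension `g`; base change `X ×_S T`), Ch. 6 §1 Definition 6.1 (p. 115).
* [GortzWedhorn2020] U. Görtz, T. Wedhorn, *Algebraic Geometry I*, 2nd ed. (2020), Remark 16.54 (p. 539) (relative dimension of a smooth
  morphism, locally constant on the source), Section (4.7) (fibres and base change).
* [EGAIV4] A. Grothendieck, J. Dieudonné, EGA IV₄ (1967), Prop. 17.10.2 (relative dimension of smooth morphisms is locally constant).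
* Tree: ★ `AbelianSchemeRelDimOfConnected` (`exists_isOfRelDim`, `connectedSpace_left`), ★ `AbelianSchemeOverFibreDim` (`dim_fibre_of_isOfRelDim`),
  ★ `AbelianSchemeOverBase` (`IsOfRelDim`, `isOfRelDim_iff`, `IsBaseChangeVia`, `IsOfRelDim.baseChange`), ★ `DualPairHatRelDimTransport`.
-/

set_option autoImplicit false

noncomputable section

universe u

open CategoryTheory CategoryTheory.Limits AlgebraicGeometry

namespace Literature.AlgebraicGeometry.AbelianSchemes

namespace AbelianSchemeOver

/-! ### §1 One fibre over a connected base -/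

section Connected

variable {S : Scheme.{u}} [ConnectedSpace S] (A : AbelianSchemeOver S)

/-- **An abelian scheme over a CONNECTED base whose fibre at one field-valued point has dimension `g` is of relative dimension `g`.**
[cite: MumfordFogartyKirwan1994, Ch. 7 §2 Definition 7.2 (p. 129)] [cite: GortzWedhorn2020, Remark 16.54 (p. 539)] -/
theorem isOfRelDim_of_dim_fibre_eq {Ω : Type u} [Field Ω] (s : Spec (.of Ω) ⟶ S) {g : ℕ}
    (h : (A.fibre s).toAbelianVariety.dim = g) : A.IsOfRelDim g := by
  obtain ⟨g', hg'⟩ := A.exists_isOfRelDim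
  rw [dim_fibre_of_isOfRelDim hg' s] at h
  exact h ▸ hg'

/-- Iff form: over a connected base, `A.IsOfRelDim g ↔ dim A_s = g` at any one field-valued point `s`.
[cite: MumfordFogartyKirwan1994, Ch. 7 §2 Definition 7.2 (p. 129)] [cite: GortzWedhorn2020, Remark 16.54 (p. 539)] -/
theorem isOfRelDim_iff_dim_fibre_eq {Ω : Type u} [Field Ω] (s : Spec (.of Ω) ⟶ S) (g : ℕ) :
    A.IsOfRelDim g ↔ (A.fibre s).toAbelianVariety.dim = g :=
  ⟨fun h => dim_fibre_of_isOfRelDim h s, A.isOfRelDim_of_dim_fibre_eq s⟩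

/-- Any two fibres of an abelian scheme over a connected base have the same dimension.
[cite: MumfordFogartyKirwan1994, Ch. 7 §2 Definition 7.2 (p. 129)] [cite: GortzWedhorn2020, Remark 16.54 (p. 539)] -/
theorem dim_fibre_eq_dim_fibre {Ω Ω' : Type u} [Field Ω] [Field Ω'] (s : Spec (.of Ω) ⟶ S) (s' : Spec (.of Ω') ⟶ S) :
    (A.fibre s).toAbelianVariety.dim = (A.fibre s').toAbelianVariety.dim := by
  obtain ⟨g, hg⟩ := A.exists_isOfRelDim
  rw [dim_fibre_of_isOfRelDim hg s, dim_fibre_of_isOfRelDim hg s']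

end Connected

/-! ### §2 Along a base-change square of group schemes (`IsBaseChangeVia`) or a bare cartesian square -/

section BaseChangeSquare

variable {S S' : Scheme.{u}} {A' : AbelianSchemeOver S'} {A : AbelianSchemeOver S}

/-- **Relative dimension rides a cartesian square**: if `G : A′ → A` over `f : S′ → S` is cartesian on underlying schemes and `A → S`
is of relative dimension `g`, so is `A′ → S′` (`SmoothOfRelativeDimension g` is stable under base change, Mathlib).
[cite: GortzWedhorn2020, Remark 16.54 (p. 539)] [cite: MumfordFogartyKirwan1994, Ch. 7 §2 Definition 7.2 (p. 129)] -/
theorem IsOfRelDim.of_isPullback {f : S' ⟶ S} {G : A'.X.left ⟶ A.X.left} (pb : IsPullback G A'.X.hom A.X.hom f) {g : ℕ}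
    (hA : A.IsOfRelDim g) : A'.IsOfRelDim g := by
  rw [isOfRelDim_iff] at hA ⊢
  haveI := smoothOfRelativeDimension_isStableUnderBaseChange (n := g)
  exact MorphismProperty.of_isPullback pb hA

/-- **Relative dimension rides `IsBaseChangeVia`** ([MFK] Def. 7.2 «`X ×_S T`»): `A′.IsBaseChangeVia A f G → A.IsOfRelDim g → A′.IsOfRelDim g`.
[cite: MumfordFogartyKirwan1994, Ch. 7 §2 Definition 7.2 (p. 129)] [cite: GortzWedhorn2020, Remark 16.54 (p. 539)] -/
theorem IsOfRelDim.of_isBaseChangeVia {f : S' ⟶ S} {G : A'.X.left ⟶ A.X.left} (h : A'.IsBaseChangeVia A f G) {g : ℕ}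
    (hA : A.IsOfRelDim g) : A'.IsOfRelDim g := by
  obtain ⟨_, pb, _, _⟩ := h
  exact IsOfRelDim.of_isPullback pb hA

/-- With the fibre read at a point of the NEW base: `A′.IsBaseChangeVia A f G`, `A.IsOfRelDim g` ⇒ `dim A′_{s′} = g`.
[cite: MumfordFogartyKirwan1994, Ch. 7 §2 Definition 7.2 (p. 129)] -/
theorem dim_fibre_eq_of_isBaseChangeVia_of_isOfRelDim {f : S' ⟶ S} {G : A'.X.left ⟶ A.X.left} (h : A'.IsBaseChangeVia A f G)
    {g : ℕ} (hA : A.IsOfRelDim g) {Ω : Type u} [Field Ω] (s' : Spec (.of Ω) ⟶ S') :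
    (A'.fibre s').toAbelianVariety.dim = g :=
  dim_fibre_of_isOfRelDim (hA.of_isBaseChangeVia h) s'

end BaseChangeSquare

/-! ### §3 The generic-to-stage direction over a connected stage: one generic fibre of dimension `g` -/

section GenericToStage

variable {S S' : Scheme.{u}} {A' : AbelianSchemeOver S'} {A : AbelianSchemeOver S}

/-- **«`dim A_K = g` ⇒ `𝒜ₜ.IsOfRelDim g`»**: if `A′ → S′` is a base change of `A → S` (`IsBaseChangeVia`, e.g. the generic fibre `A′ = A_K`
of the SP1 spread `A = 𝒜ₜ` over the connected stage `S = P ⊗ D(t)`), `S` is connected and ONE fibre of `A′` has dimension `g`, then `A`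
is of relative dimension `g` (the fibre of `A′` at `s′` is a fibre of `A` at `s′ ≫ f` up to isomorphism — here read through §2 and §1:
`A` has some relative dimension `g₀` by connectedness, it rides to `A′`, and the fibre pins `g₀ = g`).
[cite: MumfordFogartyKirwan1994, Ch. 7 §2 Definition 7.2 (p. 129)] [cite: GortzWedhorn2020, Remark 16.54 (p. 539)] -/
theorem isOfRelDim_of_isBaseChangeVia_of_dim_fibre_eq [ConnectedSpace S] {f : S' ⟶ S} {G : A'.X.left ⟶ A.X.left}
    (h : A'.IsBaseChangeVia A f G) {Ω : Type u} [Field Ω] (s' : Spec (.of Ω) ⟶ S') {g : ℕ}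
    (hdim : (A'.fibre s').toAbelianVariety.dim = g) : A.IsOfRelDim g := by
  obtain ⟨g₀, hg₀⟩ := A.exists_isOfRelDim
  have h' : (A'.fibre s').toAbelianVariety.dim = g₀ := dim_fibre_eq_of_isBaseChangeVia_of_isOfRelDim h hg₀ s'
  rw [h'] at hdim
  exact hdim ▸ hg₀

/-- The literal-`baseChange` form: `S` connected, one fibre of `A ×_S S′` of dimension `g` ⇒ `A.IsOfRelDim g`.
[cite: MumfordFogartyKirwan1994, Ch. 7 §2 Definition 7.2 (p. 129)] [cite: GortzWedhorn2020, Section (4.7); Remark 16.54 (p. 539)] -/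
theorem isOfRelDim_of_dim_fibre_baseChange_eq [ConnectedSpace S] (f : S' ⟶ S) {Ω : Type u} [Field Ω] (s' : Spec (.of Ω) ⟶ S') {g : ℕ}
    (hdim : ((A.baseChange f).fibre s').toAbelianVariety.dim = g) : A.IsOfRelDim g := by
  obtain ⟨g₀, hg₀⟩ := A.exists_isOfRelDim
  have h' : ((A.baseChange f).fibre s').toAbelianVariety.dim = g₀ := dim_fibre_of_isOfRelDim (hg₀.baseChange f) s'
  rw [h'] at hdim
  exact hdim ▸ hg₀

end GenericToStage

/-! ### §4 The dual side rides the same squares -/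

section Dual

variable {S S' : Scheme.{u}} {A : AbelianSchemeOver S}

/-- For a dual pair `D` of `A` and `f : S′ → S`: if `Â → S` has relative dimension `g` then every dual pair `D′` of `A ×_S S′` has
`Â′ → S′` of relative dimension `g` (★ `DualPair.isOfRelDim_hat_baseChange` + ★ `DualPair.isOfRelDim_hat_of_dualPair`: the base-changed
dual pair and `D′` are two dual pairs of one abelian scheme). [cite: MumfordFogartyKirwan1994, Ch. 6 §1 Cor. 6.8 (p. 118)] [cite: GortzWedhorn2020, Remark 16.54 (p. 539)] -/
theorem DualPair.isOfRelDim_hat_of_dualPair_baseChange (D : A.DualPair) (f : S' ⟶ S) (D' : (A.baseChange f).DualPair) {g : ℕ}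
    (hD : D.hat.IsOfRelDim g) : D'.hat.IsOfRelDim g :=
  DualPair.isOfRelDim_hat_of_dualPair (D.baseChange f) D' (D.isOfRelDim_hat_baseChange f hD)

end Dual

end AbelianSchemeOver

end Literature.AlgebraicGeometry.AbelianSchemes

end
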